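import Literature.MathematicalPhysics.QuantumLattice.HartreeFockUpperBound
import Literature.MathematicalPhysics.QuantumLattice.FermionEmbedLocality
import HarnessLib

/-!
# Reduced density matrices of a Slater determinant on a window: `ω_P(Γ(φ) A) = Σ_{s,t} A_{st} ρ_P^φ(s,t)`

Topic `MathematicalPhysics/QuantumLattice`, family `hubbard`; continuation of
`HartreeFockUpperBound.lean` (the quasi-free ground state `ω_P := ω_∞` of `dΓ(1 - 2P)` for an
orthogonal projection `P` on the one-particle space — the state of the Slater determinant with
one-particle density matrix `P`, Bach–Lieb–Solovej 1994 Thm 2.3) and of `FermionQuasiFreeWick.lean`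
(Gaudin's determinant formula `gibbsState_dGamma_nestedWord`). We compute the expectation in `ω_P`
of an ARBITRARY operator of a window `φ : Λ₀ ↪ Λ` of sites, embedded by the second quantisation
`Γ(φ) = fermionEmbed φ` (`InfVolFermionState.lean`), as an explicit finite alternating sum of
determinants in the entries of `P` — i.e. we construct the reduced density matrix of the Slater
state on the window:

* `HartreeFock.groundStateFunctional_nestedWord` — **Wick's theorem at zero temperature**:
  `ω_P(c†_{i₀} ⋯ c†_{i_{n-1}} c_{j_{n-1}} ⋯ c_{j₀}) = det [P_{j_l i_k}]_{k,l}` (the `β → ∞` limit of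
  Gaudin's formula, entry by entry, `det` being continuous);
* `HartreeFock.groundStateFunctional_eq_zero_of_charge` — gauge invariance: `ω_P(X) = 0` whenever
  `[N̂, X] = q X` with `q ≠ 0` (`N̂ P₀ = N P₀` for the ground projector, `HartreeFockUpperBound`);
* `single_eq_wordOp_mul_single_empty_mul_wordOp`, `single_empty_empty_eq_sum`,
  `wordOp_nestedWord_self_eq_diagonal` — the matrix units of a finite Fock space in terms of the
  Jordan–Wigner generators: `|s⟩⟨t| = c†_{s↑} |∅⟩⟨∅| c_{t↓}` (creation operators over `s` in
  increasing order, annihilation operators over `t` in decreasing order, NO sign), the vacuum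
  projection `|∅⟩⟨∅| = Σ_T (-1)^{|T|} n_T` and `n_T = c†_{T↑} c_{T↓}`; hence
  `|s⟩⟨t| = Σ_T (-1)^{|T|} c†_{(s ⧺ T)} c_{(t ⧺ T)}^{rev}` is an alternating sum of NESTED words
  (`single_eq_sum_wordOp_nestedWord`);
* `HartreeFock.slaterRDM Q s t` — for a one-body matrix `Q` on the window orbitals, the number
  `[#s = #t] · Σ_{T ⊆ (s ∪ t)ᶜ} (-1)^{|T|} det [Q_{(t⧺T)_l, (s⧺T)_k}]_{k,l}`, and the main theorem
  `HartreeFock.groundStateFunctional_fermionEmbed` —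
  **`ω_P(Γ(φ) A) = Σ_{s,t} A_{st} · slaterRDM (P|_φ) s t`** with `P|_φ` the window block
  `(a, b) ↦ P_{φ̂ a, φ̂ b}` of `P` (`φ̂ (x,σ) = (φ x, σ)`): the expectation of every embedded window
  observable in the Slater state is an explicit polynomial in the window entries of `P`
  (`groundStateFunctional_fermionEmbed_single` for matrix units).

This is the finite-dimensional content of "the reduced density matrix of a quasi-free state on a
local algebra is determined by the two-point function through Wick's theorem"
(Bratteli–Robinson II §5.2.4; Bach–Lieb–Solovej 1994 Thm 2.3 and eq. (2b.7)); it is the soundness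
statement behind certified evaluations of `⟨Φ_P, 𝒰ᴴ H 𝒰 Φ_P⟩` for Slater determinants `Φ_P` dressed
by local unitaries `𝒰` (local-unitary-cluster / "dressed Hartree–Fock" variational upper bounds).
Everything is proved; the one definition (`slaterRDM`) has a body; no named facts.

## Mathlib / tree search

Tree (REUSED): `HartreeFock.groundStateFunctional_two_point`, `tendsto_gibbsState_two_point`,
`totalNumberOp_mul_groundProj` (`HartreeFockUpperBound`); `gibbsState_dGamma_nestedWord`,
`nestedWord`, `wordOp`, `letterOp` (`FermionQuasiFreeWick`, `FermionTraceFactorization`);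
`tendsto_gibbsState_atTop_holds`, `groundStateFunctional_apply`, `groundProj` (`FinDimSpectrum*`);
`creation_mul_single`, `single_mul_annihilation`, `fermionEmbed`, `fermionEmbed_letterOp`
(`InfVolFermionState`, `FermionEmbedLocality`); `jwSign`, `numberAt_eq_diagonal`,
`totalNumberOp_eq_diagonal`. Mathlib: `Matrix.matrix_eq_sum_single`, `Continuous.matrix_det`,
`tendsto_pi_nhds`, `Finset.sum_powerset_neg_one_pow_card…`, `Fin.append`, `List.ofFn_fin_append`,
`Fin.append_comp_rev`, `Matrix.det_zero_of_row_eq / column_eq`. `lean search 'reduced.*density|slater.*RDM|Wick.*ground'`: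
no window reduced density matrix of a Slater state in Mathlib or the tree.

## References

* V. Bach, E. H. Lieb, J. P. Solovej, *Generalized Hartree–Fock theory and the Hubbard model*,
  J. Stat. Phys. 76 (1994) 3–89, Thm 2.3 (quasi-free states are determined by the one-particle
  density matrix via Wick's theorem), eq. (2b.7). [BachLiebSolovej1994]
* O. Bratteli, D. W. Robinson, *Operator Algebras and Quantum Statistical Mechanics 2* (2nd ed.,
  1997), §5.2.2 (local CAR algebras, matrix units), §5.2.4 (gauge-invariant quasi-free states).
  [BratteliRobinsonII1997]
* M. Gaudin, Nucl. Phys. 15 (1960) 89 (the determinant formula). [Gaudin1960]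
-/

noncomputable section

namespace Literature.MathematicalPhysics.QuantumLattice

open Matrix Finset Filter Topology HubbardWave0
open scoped ComplexOrder

/-! ### §1. Wick's theorem at zero temperature and the charge selection rule -/

namespace HartreeFock

section GroundState

variable {ι : Type*} [LinearOrder ι] [Fintype ι]

/-- **Wick's theorem for the Slater state** (zero-temperature limit of Gaudin's determinant
formula): `ω_P(c†_{i₀} ⋯ c†_{i_{n-1}} c_{j_{n-1}} ⋯ c_{j₀}) = det [P_{j_l, i_k}]_{k,l}` for every
orthogonal projection `P` and all index maps `i, j : Fin n → ι` (repetitions allowed: both sides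
vanish). BLS94 Thm 2.3; Bratteli–Robinson II §5.2.4. [cite: BachLiebSolovej1994, Thm 2.3] -/
theorem groundStateFunctional_nestedWord {P : Matrix ι ι ℂ} (hP : P.IsHermitian) (hPP : P * P = P)
    (n : ℕ) (i j : Fin n → ι) :
    (dGamma (hfOneBody P)).groundStateFunctional (wordOp (nestedWord n i j)) =
      (Matrix.of fun k l => P (j l) (i k)).det := by
  haveI : Nonempty (Finset ι) := ⟨∅⟩
  have hK : (dGamma (hfOneBody P)).IsHermitian := isHermitian_dGamma (isHermitian_hfOneBody hP)
  -- the matrix of thermal two-point functions tends to `[P_{j_l i_k}]` entrywise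
  have hM : Tendsto (fun β : ℝ => fun k l =>
      gibbsState β (dGamma (hfOneBody P)) (creation (i k) * annihilation (j l)))
      atTop (𝓝 (fun k l => P (j l) (i k))) :=
    tendsto_pi_nhds.2 fun k => tendsto_pi_nhds.2 fun l => tendsto_gibbsState_two_point hP hPP (i k) (j l)
  have hc : Continuous fun A : Fin n → Fin n → ℂ => (Matrix.of A).det :=
    Continuous.matrix_det continuous_id
  have hdet := (hc.tendsto _).comp hM
  refine tendsto_nhds_unique (tendsto_gibbsState_atTop_holds hK _) ?_
  refine hdet.congr' (Eventually.of_forall fun β => ?_)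
  simp only [Function.comp_apply]
  exact (gibbsState_dGamma_nestedWord (isHermitian_hfOneBody hP) β n i j).symm

/-- **Charge selection rule** (gauge invariance of the Slater state): if `N̂ X - X N̂ = q X` with
`q ≠ 0` then `ω_P(X) = 0` (the ground projector `P₀` of `dΓ(1 - 2P)` satisfies `N̂ P₀ = N P₀ = P₀ N̂`,
so `q · tr(P₀ X) = tr(P₀ N̂ X) - tr(P₀ X N̂) = 0`). BLS94 Thm 2.3 (gauge-invariant quasi-free
states). [cite: BachLiebSolovej1994, Thm 2.3] -/
theorem groundStateFunctional_eq_zero_of_charge {P : Matrix ι ι ℂ} (hP : P.IsHermitian)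
    (hPP : P * P = P) {N : ℕ} (htr : P.trace = N) {X : Matrix (Finset ι) (Finset ι) ℂ} {q : ℂ}
    (hq : q ≠ 0) (hX : totalNumberOp * X - X * totalNumberOp = q • X) :
    (dGamma (hfOneBody P)).groundStateFunctional X = 0 := by
  set K := dGamma (hfOneBody P) with hKdef
  set P₀ := K.groundProj with hP₀
  have hNP : totalNumberOp * P₀ = (N : ℂ) • P₀ := totalNumberOp_mul_groundProj hP hPP htr
  have hP₀h : P₀ᴴ = P₀ := (groundProj_isHermitian K).eq
  have hPN : P₀ * totalNumberOp = (N : ℂ) • P₀ := by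
    have h := congrArg Matrix.conjTranspose hNP
    rw [conjTranspose_mul, conjTranspose_totalNumberOp, conjTranspose_smul, hP₀h, star_natCast] at h
    exact h
  have h1 : (P₀ * (totalNumberOp * X - X * totalNumberOp)).trace = q * (P₀ * X).trace := by
    rw [hX, Matrix.mul_smul, trace_smul, smul_eq_mul]
  have h2 : (P₀ * (totalNumberOp * X)).trace = (N : ℂ) * (P₀ * X).trace := by
    rw [← Matrix.mul_assoc, hPN, Matrix.smul_mul, trace_smul, smul_eq_mul]
  have h3 : (P₀ * (X * totalNumberOp)).trace = (N : ℂ) * (P₀ * X).trace := by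
    rw [trace_mul_comm, Matrix.mul_assoc, hNP, Matrix.mul_smul, trace_smul, smul_eq_mul,
      trace_mul_comm]
  have h0 : q * (P₀ * X).trace = 0 := by
    rw [← h1, Matrix.mul_sub, trace_sub, h2, h3, sub_self]
  rw [groundStateFunctional_apply]
  change (P₀.trace)⁻¹ * (P₀ * X).trace = 0
  rw [(mul_eq_zero.mp h0).resolve_left hq, mul_zero]

end GroundState

end HartreeFock

/-! ### §2. Matrix units of a finite Fock space as words in the Jordan–Wigner generators -/

section MatrixUnits

variable {κ : Type*} [LinearOrder κ] [Fintype κ]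

omit [Fintype κ] in
/-- The Jordan–Wigner sign of an orbital below all occupied ones is `+1`. [folklore] -/
theorem jwSign_eq_one_of_forall_lt {i : κ} {s : Finset κ} (h : ∀ j ∈ s, i < j) : jwSign i s = 1 := by
  rw [jwSign, Finset.filter_eq_empty_iff.2 fun j hj hji => lt_asymm (h j hj) hji, card_empty, pow_zero]

/-- `c†_m D c_m = diag (s ↦ [m ∈ s] D(s ∖ m))` for a diagonal `D`. [folklore] -/
theorem creation_mul_diagonal_mul_annihilation (m : κ) (f : Finset κ → ℂ) :
    creation m * diagonal f * annihilation m =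
      diagonal fun s => if m ∈ s then f (s.erase m) else 0 := by
  ext u v
  rw [Matrix.mul_apply, diagonal_apply]
  have key : ∀ w, (creation m * diagonal f) u w * annihilation m w v =
      if w = v.erase m then (if m ∈ v ∧ u = v then f (v.erase m) else 0) else 0 := by
    intro w
    rw [mul_diagonal, creation_apply, annihilation_apply]
    by_cases hw : m ∉ w ∧ v = insert m w
    · rw [if_pos hw]
      have hwv : w = v.erase m := by rw [hw.2, erase_insert hw.1]
      have hmv : m ∈ v := by rw [hw.2]; exact mem_insert_self m w
      rw [if_pos hwv]
      by_cases hu : u = v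
      · rw [if_pos ⟨hw.1, hu.trans hw.2⟩, if_pos ⟨hmv, hu⟩, hwv, mul_assoc, mul_comm (f _),
          ← mul_assoc, jwSign_mul_self, one_mul]
      · rw [if_neg (fun h => hu (h.2.trans hw.2.symm)), zero_mul, zero_mul,
          if_neg (fun h => hu h.2)]
    · rw [if_neg hw, mul_zero]
      by_cases hwv : w = v.erase m
      · rw [if_pos hwv, if_neg]
        rintro ⟨hmv, -⟩
        exact hw ⟨hwv ▸ notMem_erase m v, by rw [hwv, insert_erase hmv]⟩
      · rw [if_neg hwv]
  simp_rw [key]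
  rw [Finset.sum_ite_eq' univ (v.erase m), if_pos (mem_univ _)]
  by_cases hu : u = v
  · subst hu
    by_cases hm : m ∈ u
    · rw [if_pos ⟨hm, rfl⟩, if_pos rfl, if_pos hm]
    · rw [if_neg (fun h => hm h.1), if_pos rfl, if_neg hm]
  · rw [if_neg (fun h => hu h.2), if_neg hu]

/-- The creation operators over a strictly increasing family, applied (in increasing order, the
smallest acting last) to `|∅⟩⟨t|`, give `|{i₀,…,i_{k-1}}⟩⟨t|` with NO sign:
`c†_{i₀} ⋯ c†_{i_{k-1}} |∅⟩⟨t| = |ran i⟩⟨t|`. [cite: BratteliRobinsonII1997, §5.2.2] -/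
theorem wordOp_ofFn_creation_mul_single_empty :
    ∀ (k : ℕ) (i : Fin k → κ), StrictMono i → ∀ t : Finset κ,
      wordOp (List.ofFn fun p => ((i p, true) : JWLetter κ)) * Matrix.single ∅ t (1 : ℂ) =
        Matrix.single (univ.image i) t 1 := by
  intro k
  induction k with
  | zero =>
    intro i _ t
    rw [List.ofFn_zero, wordOp_nil, Matrix.one_mul, Finset.univ_eq_empty, image_empty]
  | succ k ih =>
    intro i hi t
    have h0 : i 0 ∉ univ.image (fun p : Fin k => i p.succ) := by
      rw [mem_image]
      rintro ⟨p, -, hp⟩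
      exact (hi (Fin.succ_pos p)).ne' hp
    have himg : univ.image i = insert (i 0) (univ.image fun p : Fin k => i p.succ) := by
      ext x
      simp only [mem_image, mem_univ, true_and, mem_insert]
      constructor
      · rintro ⟨p, rfl⟩
        rcases Fin.eq_zero_or_eq_succ p with rfl | ⟨q, rfl⟩
        · exact Or.inl rfl
        · exact Or.inr ⟨q, rfl⟩
      · rintro (rfl | ⟨q, rfl⟩)
        · exact ⟨0, rfl⟩
        · exact ⟨q.succ, rfl⟩
    rw [List.ofFn_succ, wordOp_cons, Matrix.mul_assoc,
      ih (fun p : Fin k => i p.succ) (hi.comp Fin.strictMono_succ) t, letterOp, if_pos rfl,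
      creation_mul_single h0, jwSign_eq_one_of_forall_lt, one_smul, himg]
    intro j hj
    obtain ⟨p, -, rfl⟩ := mem_image.1 hj
    exact hi (Fin.succ_pos p)

/-- The annihilation operators over a strictly increasing family, multiplied (in decreasing
order) onto `|s⟩⟨t₀|` from the right, give `|s⟩⟨t₀ ∪ ran j|` with NO sign when `t₀` lies above
the family: `|s⟩⟨t₀| c_{j_{k-1}} ⋯ c_{j₀} = |s⟩⟨t₀ ∪ ran j|`. [cite: BratteliRobinsonII1997, §5.2.2] -/
theorem single_mul_wordOp_ofFn_annihilation_rev :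
    ∀ (k : ℕ) (j : Fin k → κ), StrictMono j → ∀ s t₀ : Finset κ, (∀ x ∈ t₀, ∀ p, j p < x) →
      Matrix.single s t₀ (1 : ℂ) * wordOp (List.ofFn fun p => ((j (Fin.rev p), false) : JWLetter κ)) =
        Matrix.single s (t₀ ∪ univ.image j) 1 := by
  intro k
  induction k with
  | zero =>
    intro j _ s t₀ _
    rw [List.ofFn_zero, wordOp_nil, Matrix.mul_one, Finset.univ_eq_empty, image_empty, union_empty]
  | succ k ih =>
    intro j hj s t₀ ht₀
    have hlast : j (Fin.last k) ∉ t₀ := fun h => lt_irrefl _ (ht₀ _ h (Fin.last k))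
    have himg : univ.image j = insert (j (Fin.last k)) (univ.image (j ∘ Fin.castSucc)) := by
      ext x
      simp only [mem_image, mem_univ, true_and, mem_insert, Function.comp_apply]
      constructor
      · rintro ⟨p, rfl⟩
        rcases Fin.eq_castSucc_or_eq_last p with ⟨q, rfl⟩ | rfl
        · exact Or.inr ⟨q, rfl⟩
        · exact Or.inl rfl
      · rintro (rfl | ⟨q, rfl⟩)
        · exact ⟨Fin.last k, rfl⟩
        · exact ⟨q.castSucc, rfl⟩
    have hfun : (fun p : Fin (k + 1) => ((j (Fin.rev p), false) : JWLetter κ)) ∘ Fin.succ =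
        fun p : Fin k => (((j ∘ Fin.castSucc) (Fin.rev p), false) : JWLetter κ) := by
      funext p
      simp only [Function.comp_apply, Fin.rev_succ]
    rw [List.ofFn_succ, wordOp_cons, ← Matrix.mul_assoc, letterOp, Fin.rev_zero]
    simp only [Bool.false_eq_true, ↓reduceIte]
    rw [single_mul_annihilation s hlast, jwSign_eq_one_of_forall_lt (fun x hx => ht₀ x hx _), one_smul]
    have h := ih (j ∘ Fin.castSucc) (hj.comp Fin.strictMono_castSucc) s (insert (j (Fin.last k)) t₀) ?_
    · rw [show (List.ofFn fun p : Fin k => ((j (Fin.rev p.succ), false) : JWLetter κ)) =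
          List.ofFn fun p : Fin k => (((j ∘ Fin.castSucc) (Fin.rev p), false) : JWLetter κ) from
        congrArg List.ofFn hfun, h, himg, insert_union, union_insert]
    · intro x hx p
      rcases mem_insert.1 hx with rfl | hx
      · exact hj (Fin.castSucc_lt_last p)
      · exact ht₀ x hx _

/-- **Matrix units as words**: `|s⟩⟨t| = c†_{s₀} ⋯ c†_{s_{k-1}} |∅⟩⟨∅| c_{t_{l-1}} ⋯ c_{t₀}` for the
increasing enumerations of `s` and `t`. [cite: BratteliRobinsonII1997, §5.2.2] -/
theorem single_eq_wordOp_mul_single_empty_mul_wordOp (s t : Finset κ) {k l : ℕ} (hs : s.card = k)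
    (ht : t.card = l) :
    Matrix.single s t (1 : ℂ) =
      wordOp (List.ofFn fun p => ((s.orderEmbOfFin hs p, true) : JWLetter κ)) * Matrix.single ∅ ∅ 1 *
        wordOp (List.ofFn fun p => ((t.orderEmbOfFin ht (Fin.rev p), false) : JWLetter κ)) := by
  rw [Matrix.mul_assoc, single_mul_wordOp_ofFn_annihilation_rev l _ (t.orderEmbOfFin ht).strictMono
      ∅ ∅ (fun x hx => absurd hx (notMem_empty x)), empty_union,
    wordOp_ofFn_creation_mul_single_empty k _ (s.orderEmbOfFin hs).strictMono]
  congr 1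
  · rw [← coe_inj, coe_image, coe_univ, Set.image_univ, Finset.range_orderEmbOfFin]
  · rw [← coe_inj, coe_image, coe_univ, Set.image_univ, Finset.range_orderEmbOfFin]

/-- **The vacuum projection is an alternating sum of occupation products**:
`|∅⟩⟨∅| = ∏_m (1 - n_m) = Σ_T (-1)^{|T|} n_T`, `n_T = diag [T ⊆ ·]`. [cite: BratteliRobinsonII1997, §5.2.2] -/
theorem single_empty_empty_eq_sum_diagonal :
    Matrix.single (∅ : Finset κ) ∅ (1 : ℂ) =
      ∑ T : Finset κ, (-1 : ℂ) ^ T.card • diagonal (fun s => if T ⊆ s then (1 : ℂ) else 0) := by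
  ext u v
  rw [Matrix.single_apply, Matrix.sum_apply]
  simp only [Matrix.smul_apply, diagonal_apply, smul_eq_mul, mul_ite, mul_one, mul_zero]
  by_cases huv : u = v
  · subst huv
    simp only [if_true, and_self]
    rw [← Finset.sum_filter]
    have hf : univ.filter (fun T : Finset κ => T ⊆ u) = u.powerset := by
      ext T; simp
    rw [hf]
    have hz := (Finset.sum_powerset_neg_one_pow_card (x := u))
    have hc : (∑ T ∈ u.powerset, (-1 : ℂ) ^ T.card) = ((∑ T ∈ u.powerset, (-1 : ℤ) ^ T.card : ℤ) : ℂ) := by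
      push_cast; rfl
    rw [hc, hz]
    by_cases hu : u = ∅
    · rw [if_pos hu, if_pos hu.symm, Int.cast_one]
    · rw [if_neg hu, if_neg (Ne.symm hu), Int.cast_zero]
  · rw [if_neg (fun h => huv (h.1.symm.trans h.2))]
    simp only [huv, if_false]
    rw [Finset.sum_const_zero]

/-- Peeling a nested word: `c†_{i₀} (c†_{i₁} ⋯ c_{j₁}) c_{j₀}`. [folklore] -/
theorem wordOp_nestedWord_succ (r : ℕ) (i j : Fin (r + 1) → κ) :
    wordOp (nestedWord (r + 1) i j) =
      creation (i 0) * wordOp (nestedWord r (fun p => i p.succ) (fun p => j p.succ)) * annihilation (j 0) := by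
  have h1 : List.ofFn (fun k : Fin (r + 1) => ((i k, true) : JWLetter κ)) =
      (i 0, true) :: List.ofFn (fun k : Fin r => ((i k.succ, true) : JWLetter κ)) := List.ofFn_succ
  have h2 : List.ofFn (fun k : Fin (r + 1) => ((j (Fin.rev k), false) : JWLetter κ)) =
      List.ofFn (fun k : Fin r => ((j (Fin.rev k).succ, false) : JWLetter κ)) ++ [(j 0, false)] := by
    rw [List.ofFn_succ', List.concat_eq_append]
    congr 2
    · funext k
      rw [Fin.rev_castSucc]
    · rw [Fin.rev_last]
  rw [nestedWord, nestedWord, h1, h2, List.cons_append, wordOp_cons, ← List.append_assoc,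
    wordOp_append, wordOp_append, wordOp_cons, wordOp_nil, Matrix.mul_one, letterOp, if_pos rfl, letterOp]
  simp only [Bool.false_eq_true, ↓reduceIte, Matrix.mul_assoc]

/-- **Occupation products are nested words**: `c†_{m₀} ⋯ c†_{m_{r-1}} c_{m_{r-1}} ⋯ c_{m₀} = n_{m₀} ⋯ n_{m_{r-1}}
= diag [ran m ⊆ ·]` for an injective family `m`. [cite: BratteliRobinsonII1997, §5.2.2] -/
theorem wordOp_nestedWord_self_eq_diagonal :
    ∀ (r : ℕ) (m : Fin r → κ), Function.Injective m →
      wordOp (nestedWord r m m) = diagonal (fun s => if univ.image m ⊆ s then (1 : ℂ) else 0) := by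
  intro r
  induction r with
  | zero =>
    intro m _
    simp [nestedWord, Finset.univ_eq_empty]
  | succ r ih =>
    intro m hm
    rw [wordOp_nestedWord_succ, ih (fun p => m p.succ) (hm.comp (Fin.succ_injective r)),
      creation_mul_diagonal_mul_annihilation]
    congr 1
    funext s
    have himg : univ.image m = insert (m 0) (univ.image fun p : Fin r => m p.succ) := by
      ext x
      simp only [mem_image, mem_univ, true_and, mem_insert]
      constructor
      · rintro ⟨p, rfl⟩
        rcases Fin.eq_zero_or_eq_succ p with rfl | ⟨q, rfl⟩
        · exact Or.inl rfl
        · exact Or.inr ⟨q, rfl⟩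
      · rintro (rfl | ⟨q, rfl⟩)
        · exact ⟨0, rfl⟩
        · exact ⟨q.succ, rfl⟩
    have h0 : m 0 ∉ univ.image (fun p : Fin r => m p.succ) := by
      rw [mem_image]
      rintro ⟨p, -, hp⟩
      exact Fin.succ_ne_zero p (hm hp)
    by_cases hms : m 0 ∈ s
    · have hiff : (univ.image fun p : Fin r => m p.succ) ⊆ s.erase (m 0) ↔ univ.image m ⊆ s := by
        rw [himg, Finset.insert_subset_iff]
        constructor
        · exact fun h => ⟨hms, h.trans (erase_subset _ _)⟩
        · exact fun h x hx => mem_erase.2 ⟨fun h' => h0 (h' ▸ hx), h.2 hx⟩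
      rw [if_pos hms]
      simp only [hiff]
    · have hnot : ¬ univ.image m ⊆ s := fun h => hms (h (by rw [himg]; exact mem_insert_self _ _))
      rw [if_neg hms, if_neg hnot]

omit [LinearOrder κ] [Fintype κ] in
/-- Splitting an appended nested word: `c†_{f} c†_{g} c_{g}^{rev} c_{f'}^{rev}`. [folklore] -/
theorem nestedWord_append (a b : ℕ) (f f' : Fin a → κ) (g : Fin b → κ) :
    nestedWord (a + b) (Fin.append f g) (Fin.append f' g) =
      List.ofFn (fun p => ((f p, true) : JWLetter κ)) ++ nestedWord b g g ++
        List.ofFn (fun p => ((f' (Fin.rev p), false) : JWLetter κ)) := by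
  have h1 : List.ofFn (fun k : Fin (a + b) => ((Fin.append f g k, true) : JWLetter κ)) =
      List.ofFn (fun p => ((f p, true) : JWLetter κ)) ++ List.ofFn (fun p => ((g p, true) : JWLetter κ)) := by
    rw [List.ofFn_add]
    simp [Fin.append_right]
  have h2 : List.ofFn (fun k : Fin (a + b) => ((Fin.append f' g (Fin.rev k), false) : JWLetter κ)) =
      List.ofFn (fun p : Fin b => ((g (Fin.rev p), false) : JWLetter κ)) ++
        List.ofFn (fun p : Fin a => ((f' (Fin.rev p), false) : JWLetter κ)) := by
    have h3 : (fun k : Fin (a + b) => ((Fin.append f' g (Fin.rev k), false) : JWLetter κ)) =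
        fun k : Fin (a + b) => ((Fin.append (g ∘ Fin.rev) (f' ∘ Fin.rev) (k.cast (Nat.add_comm a b)), false) : JWLetter κ) := by
      funext k; rw [Fin.append_rev]
    rw [h3, List.ofFn_congr (Nat.add_comm a b), List.ofFn_add]
    simp [Fin.append_right]
  rw [nestedWord, nestedWord, h1, h2]
  simp only [List.append_assoc]

/-- **Matrix units as alternating sums of nested words**: for `#s = #t`,
`|s⟩⟨t| = Σ_T (-1)^{|T|} c†_{s ⧺ T} (c_{t ⧺ T})^{rev}`, where `s ⧺ T` is the increasing enumeration of
`s` followed by that of `T`. [cite: BratteliRobinsonII1997, §5.2.2] -/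
theorem single_eq_sum_wordOp_nestedWord (s t : Finset κ) (h : s.card = t.card) :
    Matrix.single s t (1 : ℂ) = ∑ T : Finset κ, (-1 : ℂ) ^ T.card •
      wordOp (nestedWord (t.card + T.card) (Fin.append (s.orderEmbOfFin h) (T.orderEmbOfFin rfl))
        (Fin.append (t.orderEmbOfFin rfl) (T.orderEmbOfFin rfl))) := by
  rw [single_eq_wordOp_mul_single_empty_mul_wordOp s t h rfl, single_empty_empty_eq_sum_diagonal,
    Finset.mul_sum, Finset.sum_mul]
  refine Finset.sum_congr rfl fun T _ => ?_
  have hT : univ.image (T.orderEmbOfFin rfl) = T := by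
    rw [← coe_inj, coe_image, coe_univ, Set.image_univ, Finset.range_orderEmbOfFin]
  rw [Matrix.mul_smul, Matrix.smul_mul, nestedWord_append, wordOp_append, wordOp_append,
    wordOp_nestedWord_self_eq_diagonal _ _ (T.orderEmbOfFin rfl).injective, hT, Matrix.mul_assoc]

end MatrixUnits

/-! ### §3. Embedded window observables in the Slater state -/

section Window

variable {Λ₀ Λ : Type*} [LinearOrder Λ₀] [Fintype Λ₀] [LinearOrder Λ] [Fintype Λ]

/-- `Γ(φ)` maps words to words, letterwise (`c^♯_{xσ} ↦ c^♯_{φx,σ}`). [cite: BratteliRobinsonII1997, §5.2.2] -/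
theorem fermionEmbed_wordOp (φ : Λ₀ ↪ Λ) (w : List (JWLetter (Orb Λ₀))) :
    fermionEmbed φ (wordOp w) =
      wordOp (w.map fun l => ((orb (φ (ofLex l.1).1) (ofLex l.1).2, l.2) : JWLetter (Orb Λ))) := by
  induction w with
  | nil => rw [wordOp_nil, List.map_nil, wordOp_nil, fermionEmbed_one]
  | cons l w ih => rw [wordOp_cons, fermionEmbed_mul, fermionEmbed_letterOp, ih, List.map_cons, wordOp_cons]

/-- `Γ(φ)` maps nested words to nested words. [cite: BratteliRobinsonII1997, §5.2.2] -/
theorem fermionEmbed_wordOp_nestedWord (φ : Λ₀ ↪ Λ) (n : ℕ) (i j : Fin n → Orb Λ₀) :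
    fermionEmbed φ (wordOp (nestedWord n i j)) =
      wordOp (nestedWord n (fun k => orb (φ (ofLex (i k)).1) (ofLex (i k)).2)
        (fun k => orb (φ (ofLex (j k)).1) (ofLex (j k)).2)) := by
  rw [fermionEmbed_wordOp, nestedWord, nestedWord, List.map_append, List.map_ofFn, List.map_ofFn]
  rfl

omit [LinearOrder Λ₀] [Fintype Λ] in
/-- The orbitals over the image sites are the images of the window orbitals. [folklore] -/
theorem orbs_map_eq_image (φ : Λ₀ ↪ Λ) :
    orbs ((univ : Finset Λ₀).map φ) = univ.image fun a : Orb Λ₀ => orb (φ (ofLex a).1) (ofLex a).2 := by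
  ext i
  rw [mem_orbs, mem_image]
  constructor
  · intro h
    obtain ⟨x, -, hx⟩ := Finset.mem_map.1 h
    refine ⟨orb x (ofLex i).2, mem_univ _, ?_⟩
    change toLex (φ (ofLex (toLex (x, (ofLex i).2))).1, (ofLex (toLex (x, (ofLex i).2))).2) = i
    rw [ofLex_toLex, hx]
    rfl
  · rintro ⟨a, -, rfl⟩
    exact Finset.mem_map_of_mem _ (mem_univ _)

/-- `Γ(φ) N̂_{Λ₀} = Σ_{i ∈ orbs(φ Λ₀)} n_i`: the embedded number operator counts the particles in
the window. [folklore] -/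
theorem fermionEmbed_totalNumberOp (φ : Λ₀ ↪ Λ) :
    fermionEmbed φ (totalNumberOp : Matrix (Finset (Orb Λ₀)) (Finset (Orb Λ₀)) ℂ) =
      ∑ i ∈ orbs ((univ : Finset Λ₀).map φ), numberAt i := by
  have hinj : Function.Injective fun a : Orb Λ₀ => orb (φ (ofLex a).1) (ofLex a).2 := by
    intro a b hab
    have h1 := congrArg (fun i : Orb Λ => (ofLex i).1) hab
    have h2 := congrArg (fun i : Orb Λ => (ofLex i).2) hab
    simp only [orb, ofLex_toLex] at h1 h2
    exact ofLex.injective (Prod.ext (φ.injective h1) h2)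
  rw [totalNumberOp, fermionEmbed_sum, orbs_map_eq_image, Finset.sum_image fun a _ b _ h => hinj h]
  refine Finset.sum_congr rfl fun a _ => ?_
  rw [numberAt, fermionEmbed_mul, fermionEmbed_creation', fermionEmbed_annihilation', numberAt]

/-- **The particle number outside the window commutes with embedded observables**, so the charge
of an embedded observable is the embedded charge: `N̂ Γ(φ)A - Γ(φ)A N̂ = Γ(φ)(N̂₀ A - A N̂₀)`.
[cite: BratteliRobinsonII1997, §5.2.2] -/
theorem totalNumberOp_commutator_fermionEmbed (φ : Λ₀ ↪ Λ) (A : Matrix (Finset (Orb Λ₀)) (Finset (Orb Λ₀)) ℂ) :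
    totalNumberOp * fermionEmbed φ A - fermionEmbed φ A * totalNumberOp =
      fermionEmbed φ (totalNumberOp * A - A * totalNumberOp) := by
  set S := orbs ((univ : Finset Λ₀).map φ) with hS
  have hsplit : (totalNumberOp : Matrix (Finset (Orb Λ)) (Finset (Orb Λ)) ℂ) =
      fermionEmbed φ totalNumberOp + ∑ i ∈ Sᶜ, numberAt i := by
    rw [fermionEmbed_totalNumberOp, totalNumberOp, ← Finset.sum_add_sum_compl S]
  have hrest : (∑ i ∈ Sᶜ, numberAt i) ∈ carEvenSubalgebra Sᶜ :=
    Subalgebra.sum_mem _ fun i hi => creation_mul_annihilation_mem_carEvenSubalgebra hi hi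
  have hcomm : Commute (∑ i ∈ Sᶜ, numberAt i) (fermionEmbed φ A) :=
    commute_fermionEmbed_of_mem_carEvenSubalgebra φ A hrest disjoint_compl_left
  rw [hsplit, Matrix.add_mul, Matrix.mul_add, hcomm.eq, fermionEmbed_sub, fermionEmbed_mul,
    fermionEmbed_mul]
  abel

/-- The charge of a matrix unit: `N̂₀ |s⟩⟨t| - |s⟩⟨t| N̂₀ = (#s - #t) |s⟩⟨t|`. [folklore] -/
theorem totalNumberOp_commutator_single (s t : Finset (Orb Λ₀)) :
    totalNumberOp * Matrix.single s t (1 : ℂ) - Matrix.single s t 1 * totalNumberOp =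
      ((s.card : ℂ) - t.card) • Matrix.single s t 1 := by
  ext u v
  rw [totalNumberOp_eq_diagonal, Matrix.sub_apply, diagonal_mul, mul_diagonal, Matrix.smul_apply,
    Matrix.single_apply, smul_eq_mul]
  by_cases h : s = u ∧ t = v
  · rw [if_pos h, ← h.1, ← h.2, mul_one, one_mul, mul_one]
  · rw [if_neg h, mul_zero, zero_mul, sub_zero, mul_zero]

namespace HartreeFock

/-- **The reduced density matrix of a Slater determinant on a window**, as an explicit function of
the window block `Q` of its one-particle density matrix: for occupation configurations `s, t` of
the window orbitals,
`slaterRDM Q s t = [#s = #t] · Σ_{T ⊆ (s ∪ t)ᶜ} (-1)^{|T|} det [Q_{(t⧺T)_l, (s⧺T)_k}]_{k,l}`,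
where `s ⧺ T : Fin (#t + #T) → (orbitals)` is the increasing enumeration of `s` followed by that of
`T`, and `Q` is taken in the convention of the tree's one-particle density matrices,
`Q a b = ω(c†_b c_a)` (`groundStateFunctional_two_point`: `ω_P(c†_i c_j) = P_{ji}`).
By `groundStateFunctional_fermionEmbed_single` this is `ω_P(Γ(φ)|s⟩⟨t|)`, i.e. the
`(t, s)` entry of the density matrix of the Slater state `Φ_P` reduced to the window
(`Tr(ρ_W X) = Σ_{s,t} X_{st} ρ_W(t,s)`); Wick's theorem (BLS94 Thm 2.3) written out on the
occupation basis. [cite: BachLiebSolovej1994, Thm 2.3] -/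
def slaterRDM {κ : Type*} [LinearOrder κ] [Fintype κ] (Q : Matrix κ κ ℂ) (s t : Finset κ) : ℂ :=
  if h : s.card = t.card then
    ∑ T ∈ ((s ∪ t)ᶜ).powerset, (-1 : ℂ) ^ T.card *
      (Matrix.of fun k l : Fin (t.card + T.card) =>
        Q (Fin.append (t.orderEmbOfFin rfl) (T.orderEmbOfFin rfl) l)
          (Fin.append (s.orderEmbOfFin h) (T.orderEmbOfFin rfl) k)).det
  else 0

/-- Off the particle-number diagonal the reduced density matrix vanishes. [folklore] -/
theorem slaterRDM_of_card_ne {κ : Type*} [LinearOrder κ] [Fintype κ] (Q : Matrix κ κ ℂ)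
    {s t : Finset κ} (h : s.card ≠ t.card) : slaterRDM Q s t = 0 := by
  rw [slaterRDM, dif_neg h]

/-- **Slater-state expectation of an embedded matrix unit**: for an orthogonal projection `P`
with `tr P = N`, a window `φ : Λ₀ ↪ Λ` and configurations `s, t` of the window,
`ω_P(Γ(φ) |s⟩⟨t|) = slaterRDM (P|_φ) s t` with `P|_φ (a, b) = P_{φ̂a, φ̂b}`. (Charge selection for
`#s ≠ #t`; otherwise `|s⟩⟨t|` is an alternating sum of nested words, each evaluated by Wick's
theorem; the words meeting `s ∪ t` twice vanish as determinants with two equal rows or columns.)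
[cite: BachLiebSolovej1994, Thm 2.3] -/
theorem groundStateFunctional_fermionEmbed_single {P : Matrix (Orb Λ) (Orb Λ) ℂ} (hP : P.IsHermitian)
    (hPP : P * P = P) {N : ℕ} (htr : P.trace = N) (φ : Λ₀ ↪ Λ) (s t : Finset (Orb Λ₀)) :
    (dGamma (hfOneBody P)).groundStateFunctional (fermionEmbed φ (Matrix.single s t (1 : ℂ))) =
      slaterRDM (P.submatrix (fun a : Orb Λ₀ => orb (φ (ofLex a).1) (ofLex a).2)
        (fun a : Orb Λ₀ => orb (φ (ofLex a).1) (ofLex a).2)) s t := by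
  set e : Orb Λ₀ → Orb Λ := fun a => orb (φ (ofLex a).1) (ofLex a).2 with he
  by_cases h : s.card = t.card
  · rw [slaterRDM, dif_pos h, single_eq_sum_wordOp_nestedWord s t h, fermionEmbed_sum, map_sum]
    -- every term is a determinant
    have hterm : ∀ T : Finset (Orb Λ₀),
        (dGamma (hfOneBody P)).groundStateFunctional (fermionEmbed φ ((-1 : ℂ) ^ T.card •
          wordOp (nestedWord (t.card + T.card) (Fin.append (s.orderEmbOfFin h) (T.orderEmbOfFin rfl))
            (Fin.append (t.orderEmbOfFin rfl) (T.orderEmbOfFin rfl))))) =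
        (-1 : ℂ) ^ T.card * (Matrix.of fun k l : Fin (t.card + T.card) =>
          (P.submatrix e e) (Fin.append (t.orderEmbOfFin rfl) (T.orderEmbOfFin rfl) l)
            (Fin.append (s.orderEmbOfFin h) (T.orderEmbOfFin rfl) k)).det := by
      intro T
      rw [fermionEmbed_smul, map_smul, fermionEmbed_wordOp_nestedWord,
        groundStateFunctional_nestedWord hP hPP, smul_eq_mul]
      rfl
    simp only [hterm]
    -- the terms with `T` meeting `s ∪ t` vanish
    symm
    refine Finset.sum_subset (subset_univ _) fun T _ hT => ?_
    rw [mem_powerset, subset_compl_iff_disjoint_left, not_disjoint_iff] at hT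
    · obtain ⟨x, hxst, hxT⟩ := hT
      obtain ⟨b, hb⟩ : ∃ b : Fin T.card, T.orderEmbOfFin rfl b = x := by
        have hx : x ∈ Set.range (T.orderEmbOfFin rfl) := by rw [range_orderEmbOfFin]; exact hxT
        exact hx
      rw [mul_eq_zero]
      right
      rcases mem_union.1 hxst with hxs | hxt
      · -- two equal rows
        obtain ⟨a, ha⟩ : ∃ a : Fin t.card, s.orderEmbOfFin h a = x := by
          have hx : x ∈ Set.range (s.orderEmbOfFin h) := by rw [range_orderEmbOfFin]; exact hxs
          exact hx
        refine Matrix.det_zero_of_row_eq (i := Fin.castAdd T.card a) (j := Fin.natAdd t.card b) ?_ ?_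
        · intro hab
          have := congrArg Fin.val hab
          simp only [Fin.val_castAdd, Fin.val_natAdd] at this
          omega
        · funext l
          simp only [Matrix.of_apply, Fin.append_left, Fin.append_right, ha, hb]
      · -- two equal columns
        obtain ⟨a, ha⟩ : ∃ a : Fin t.card, t.orderEmbOfFin rfl a = x := by
          have hx : x ∈ Set.range (t.orderEmbOfFin rfl) := by rw [range_orderEmbOfFin]; exact hxt
          exact hx
        rw [← Matrix.det_transpose]
        refine Matrix.det_zero_of_row_eq (i := Fin.castAdd T.card a) (j := Fin.natAdd t.card b) ?_ ?_
        · intro hab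
          have := congrArg Fin.val hab
          simp only [Fin.val_castAdd, Fin.val_natAdd] at this
          omega
        · funext k
          simp only [Matrix.transpose_apply, Matrix.of_apply, Fin.append_left, Fin.append_right, ha, hb]
  · rw [slaterRDM, dif_neg h]
    refine groundStateFunctional_eq_zero_of_charge hP hPP htr (q := (s.card : ℂ) - t.card)
      (sub_ne_zero.2 fun h' => h (by exact_mod_cast h')) ?_
    rw [totalNumberOp_commutator_fermionEmbed, totalNumberOp_commutator_single, fermionEmbed_smul]

/-- **Expectations of embedded window observables in a Slater state.** For an orthogonal
projection `P` on the one-particle space of `Λ` with `tr P = N`, a window `φ : Λ₀ ↪ Λ`, and ANY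
operator `A` on the Fock space of the window,
`ω_P(Γ(φ) A) = Σ_{s,t} A_{st} · slaterRDM (P|_φ) s t`,
an explicit polynomial in the finitely many entries `P_{φ̂a, φ̂b}` of `P` over the window — the
reduced density matrix of the Slater determinant is determined by its two-point function
(Wick's theorem). BLS94 Thm 2.3; Bratteli–Robinson II §5.2.4. [cite: BachLiebSolovej1994, Thm 2.3] -/
theorem groundStateFunctional_fermionEmbed {P : Matrix (Orb Λ) (Orb Λ) ℂ} (hP : P.IsHermitian)
    (hPP : P * P = P) {N : ℕ} (htr : P.trace = N) (φ : Λ₀ ↪ Λ)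
    (A : Matrix (Finset (Orb Λ₀)) (Finset (Orb Λ₀)) ℂ) :
    (dGamma (hfOneBody P)).groundStateFunctional (fermionEmbed φ A) =
      ∑ s : Finset (Orb Λ₀), ∑ t : Finset (Orb Λ₀), A s t *
        slaterRDM (P.submatrix (fun a : Orb Λ₀ => orb (φ (ofLex a).1) (ofLex a).2)
          (fun a : Orb Λ₀ => orb (φ (ofLex a).1) (ofLex a).2)) s t := by
  conv_lhs => rw [Matrix.matrix_eq_sum_single A]
  rw [fermionEmbed_sum, map_sum]
  refine Finset.sum_congr rfl fun s _ => ?_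
  rw [fermionEmbed_sum, map_sum]
  refine Finset.sum_congr rfl fun t _ => ?_
  rw [show Matrix.single s t (A s t) = A s t • Matrix.single s t (1 : ℂ) by
      rw [Matrix.smul_single, smul_eq_mul, mul_one],
    fermionEmbed_smul, map_smul, groundStateFunctional_fermionEmbed_single hP hPP htr, smul_eq_mul]

end HartreeFock

end Window


end Literature.MathematicalPhysics.QuantumLattice
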